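import Summits.QuantumFields.YangMills.Theorems.BalabanUVNodesN11TStepOldBranchInnerSumOfProvisos

/-!
# DAG node N11 — THE (O3′) OBLIGATION WITH THE INNER READING PINNED TO ITS INTRINSIC VALUE: one a.e. identity per old branch between def-T's skew conditional
# expectation of the old graph piece and 11a's ζ-weighted new `Y`-sum — no chart, no per-bond data, no support clause, no reading to choose

HEADER — WORK-UNIT METADATA.  Cell `pub-ymgap`, YM-PLAN Track A (HUMAN RULING D-0062), seat `pub-ymgap-dag-n11-d` (g16; R134 fan-out base seat N11 [B14], strategy s2),
route `BalabanUVNodes`, item K1⁹ `StabilityBRunRowsAtRecordR13SepCoPHV` = stmt-QuantumFields-27364 (helper lane, `--kind proof --supports 27364 --as helper`, count-neutral).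
[I] = [Balaban1987RG1], [III] = [Balaban1988Convergent].  Composition of dag-n11-w2's `…TStepOldBranchInnerSumOfProvisos` (§1 `_of_laws`, §2 `_of_provisos`) and
`…O3OfSupplierTermRows` (the (O3′) clause in the chain's currency, generic `θ` and `rePinH θ`) — whose per-old-branch data are `Fᵢ₀ ∕ hFm₀ ∕ hin₀ ∕ hinner₀` with the inner
reading `Fᵢ₀` FREE — with the index bookkeeping of this seat's `…TStepBranchSumOldIndex` (p622584) and dag-n11-w2's `measurable_innerIntegrand_of_weights` ∕
`hgm_at_record₁₃_of_rows` (p626903), `operandRows_at_history_of_termRows` (p633460).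

WHY THIS FILE.  In the old-branch form of the (O3′) clause (this seat's `N11-O3-ROAD.md`), the consumer had to CHOOSE a measurable inner reading `Fᵢ₀ S₀` of every old-branch
graph piece through the bond-partition presentation (hin₀: `kernelTransport μ_in μ_out skew (piece_{S₀} ∘ e⁻¹) =ᵐ[μ_out] Fᵢ₀ S₀`) and then identify it on the averaging fibres with
11a's ζ-weighted new `Y`-sum (hinner₀).  But the right member of hinner₀, read on the fibre `avgRestrOfRecord y = q.1`, IS a function of the presented point `(y, q.2)` alone:
`R̃_{S₀}(y, v₂) := Σ_{Y} ζ_k(ω)·(aOp k sA w (𝐓_k(init s′,S₀)[W] Φ_{S₀∪Y}))(ω)` at `ω :=` 11a's base configuration of the glued coarse field `e′⁻¹(avgRestrOfRecord y, v₂)` updated at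
scale `k` by `y` on `sV`.  Taking `Fᵢ₀ S₀ := R̃_{S₀}` — THE INTRINSIC READING — makes `hFm₀` a theorem (the new inside integrands are jointly measurable, dag-n11-w2; the old
operator reads `init s′`, p622584) and `hinner₀` a tautology (`subst`), and leaves EXACTLY ONE displayed identity per old branch `S₀ ∈ admSOfRecord k (init s′)`:

  (hce₀)   kernelTransport μ_in μ_out skew ((w(s′)·χ_k(init s′)·𝐓_k(init s′,S₀)[W₀]Φ₀_{S₀} ∘ base_k) ∘ e⁻¹) =ᵐ[μ_out] R̃_{S₀}

— [III] (3.23)–(3.25) for ONE term of (2.18): def-T's honest conditional expectation of the old graph piece along the skew step `(y, r) ↦ (y, (avg U)(c))_{c ∉ sV′}` (print's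
`∫dU|_{Ω_{k+1}} δ(Ū V⁻¹)(…)`, [III] (3.1) with the inside δ-functions) EQUALS 11a's generation integrand `ζ(Ω^c_{k+1})·∫dA|_{Ω_{k+1}∖Λ_{k+1}} Σ_{S_{k+1}} χ … exp(−½⟨A,Δ A⟩)·(𝐓_k e^{A_{k+1}})`
((3.23)).  No chart, no Jacobian, no per-bond inversion data, no support clause, no measurability side condition on a reading.  The chart files of this seat (E–J:
`…OldBranchInnerChart`, `…PrivateInnerChart…`), dag-n11-w6's fluctuation-slice sockets and dag-n08-w2's central-window (†) are METHODS for proving (hce₀) (E's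
`innerReading_of_oldBranch_piece_of_innerChart` computes the left member by a chart integral a.e.); THIS file is the chart-free TARGET a §3 supplier must meet.

WHAT THIS FILE PROVES (0 `def`, 0 `sorry`, standard axioms; GENERIC letters `V`, `W₀`, `W`, `Φ₀`, `Φ` — the Stage-13 ∕ chain-currency editions are the sequel
`…N11O3OfIntrinsicReadingAtRecord13`).  `measurable_intrinsicReading_of_hgm` (the intrinsic reading is measurable from the `hgm` row) · `intrinsicReading_identification`
(it satisfies `hinner₀`, by `subst`) · ★ `slotsTOfRecord_succ_ae_eq_TkOfRecord_succ_of_oldBranchCondExp_of_laws` ((O3′) on the nose: `slotsT_{k+1}(s′) =ᵐ[dV′] TkOfRecord … W (k+1) s′ Φ`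
from the a.e. level-`k` form, per-old-branch graph integrability, `hgm`, the new weights' laws, a nonnegative new operand, and (hce₀)).

HONEST FRAMING.  Helper lane of K1⁹; count-neutral; compositions BY NAME; (hce₀) DISPLAYED — it is where [I] §2's change of variables, its Jacobian, the gauge fixing, `ζ` and
[III] Thm 2 live, NOT proved here; nothing of [I] §2 ∕ [III] §3 ∕ Thm 1–2 asserted; no supplier constructed; (B4) ∕ (S-α) ∕ (O3′) NOT closed; N11 NOT discharged; K1⁹ NOT closed,
no registered stub touched; counts unmoved (typed 28∕28 · discharged 5∕27 · A 5∕28).  One finite `𝕋⁴_{L^K}` programme at fixed `ε = L^{−K}`; R4 closes only the conditional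
finite-𝕋⁴ rung `BalabanLadder.UV` — NOT ℝ⁴, NOT OS, NOT a mass gap, NOT Clay.  No `sorry`, `axiom`, `def`, `instance`, `notation`.  Sources (SHAPE ∕ bookkeeping only): [III]
(2.1) p.254, (2.18) p.257, (2.20)–(2.21) p.258, (3.1) p.264, (3.23)–(3.25) p.270, §3 p.279, Thm 1 p.262, Thm 2 p.263; [I] (0.4) p.253, §2 p.267.
-/

noncomputable section

open MeasureTheory ProbabilityTheory
open scoped ENNReal NNReal BigOperators Matrix.Norms.L2Operator

namespace Summit.QuantumFields.YangMills.Theorems.BalabanUVNodesN11O3OfIntrinsicReading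

open Literature.MathematicalPhysics.QuantumFieldTheory.Balaban1983to89
open Literature.MathematicalPhysics.QuantumFieldTheory.Balaban1983to89.T4AveragingDisintegration
open BalabanUVNodesN11TStepOldBranchInnerSumOfProvisos (slotsTOfRecord_succ_ae_eq_TkOfRecord_succ_of_oldBranchInnerSum_of_laws)
open BalabanUVNodesN11TStepBranchSumOldIndex (tkBranchOfRecord_update_succ_eq_init update_succ_mem_admSSeq_succ)
open Node00 hiding SU
open Node00.Tk T4Continuum B14.Eq218Concrete
open B10Eq42TorusConstraint (bondsIn)

variable {F : T4Family} {N : ℕ} [NeZero N]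

/-! ## §1  Generic letters: the intrinsic reading is measurable, identifies itself on the fibres, and closes (O3′) on the nose -/

section Generic

variable {V : Type} [NormedAddCommGroup V] [InnerProductSpace ℝ V] [FiniteDimensional ℝ V] [MeasurableSpace V] [BorelSpace V]

/-- **THE INTRINSIC READING IS MEASURABLE** whenever the explicit new inside integrands are jointly measurable (the `hgm` row of p619836 ∕ p624357): each summand of
`R̃_{S₀}` is the `hgm` integrand of the branch `S₀ ∪ {S_{k+1} = Y}` (an element of `admSOfRecord (k+1) s′`, p622584 §1; its old operator reads `init s′`, p622584 §2) composed
with the measurable map `(y, v₂) ↦ ((avgRestrOfRecord y, v₂), y)`. [cite: Balaban1988Convergent, (2.1) p.254, (2.20)–(2.21) p.258, (3.23) p.270 (bookkeeping)] -/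
theorem measurable_intrinsicReading_of_hgm (ν : Stage7Numerics) (M : ℕ) (g : ℕ → ℝ) (p : B12.RunParams) {k : ℕ}
    {hdec : DecidableEq (PBond (F.P p.K) k)} {hdec' : DecidableEq (PBond (F.P p.K) (k + 1))}
    (s' : SeqOfRecord F ν M g p.K (k + 1)) (W : TkWeights F N V p.K) (Φ : SFluct (F.P p.K) V → B15DeterminingSets.MSField (F.P p.K) (SU N) → ℝ)
    (hgm : ∀ S ∈ admSOfRecord F ν M g p.K (k + 1) s', Measurable fun x :
        ((↥(Set.toFinite (bondsIn (k + 1) (s'.Ω (k + 1))ᶜ)).toFinset → SU N) ×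
            ({c : PBond (F.P p.K) (k + 1) // c ∉ (Set.toFinite (bondsIn (k + 1) (s'.Ω (k + 1))ᶜ)).toFinset} → SU N)) ×
          (↥(Set.toFinite (bondsIn k (s'.Ω (k + 1))ᶜ)).toFinset → SU N) =>
      zetaOp (genDataOfRecord F N V ν M g p.K W s' S k).ζ
        (aOp k (genDataOfRecord F N V ν M g p.K W s' S k).sA (genDataOfRecord F N V ν M g p.K W s' S k).w
          (tkBranchOfRecord F N V ν M g p.K W s' S k (fun ω => Φ (S, fun j => (ω j).2) (fun j => (ω j).1))))
        (Function.update (baseCfg (k + 1) ((MeasurableEquiv.piEquivPiSubtypeProd (fun _ : PBond (F.P p.K) (k + 1) => SU N)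
                (· ∈ (Set.toFinite (bondsIn (k + 1) (s'.Ω (k + 1))ᶜ)).toFinset)).symm x.1)) k
          (Function.updateFinset ((baseCfg (V := V) (k + 1) ((MeasurableEquiv.piEquivPiSubtypeProd (fun _ : PBond (F.P p.K) (k + 1) => SU N)
                (· ∈ (Set.toFinite (bondsIn (k + 1) (s'.Ω (k + 1))ᶜ)).toFinset)).symm x.1)) k).1 (Set.toFinite (bondsIn k (s'.Ω (k + 1))ᶜ)).toFinset x.2,
            ((baseCfg (V := V) (k + 1) ((MeasurableEquiv.piEquivPiSubtypeProd (fun _ : PBond (F.P p.K) (k + 1) => SU N)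
                (· ∈ (Set.toFinite (bondsIn (k + 1) (s'.Ω (k + 1))ᶜ)).toFinset)).symm x.1)) k).2)))
    (S₀ : ℕ → Set (Site (F.P p.K) 0)) (h₀ : S₀ ∈ admSOfRecord F ν M g p.K k s'.init) :
    Measurable fun z : (↥(Set.toFinite (bondsIn k (s'.Ω (k + 1))ᶜ)).toFinset → SU N) ×
        ({c : PBond (F.P p.K) (k + 1) // c ∉ (Set.toFinite (bondsIn (k + 1) (s'.Ω (k + 1))ᶜ)).toFinset} → SU N) =>
      ∑ Y ∈ (Set.toFinite {Y : Set (Site (F.P p.K) 0) | Y ∈ SClassOfRecord F ν g p.K (k + 1) ∧ Y ⊆ s'.Ω (k + 1) ∩ (s'.Λ (k + 1))ᶜ}).toFinset,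
        zetaOp (genDataOfRecord F N V ν M g p.K W s' (Function.update S₀ (k + 1) Y) k).ζ
          (aOp k (genDataOfRecord F N V ν M g p.K W s' (Function.update S₀ (k + 1) Y) k).sA
            (genDataOfRecord F N V ν M g p.K W s' (Function.update S₀ (k + 1) Y) k).w
            (tkBranchOfRecord F N V ν M g p.K W s'.init S₀ k
              (fun ω => Φ (Function.update S₀ (k + 1) Y, fun j => (ω j).2) (fun j => (ω j).1))))
          (Function.update (baseCfg (k + 1) ((MeasurableEquiv.piEquivPiSubtypeProd (fun _ : PBond (F.P p.K) (k + 1) => SU N)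
            (· ∈ (Set.toFinite (bondsIn (k + 1) (s'.Ω (k + 1))ᶜ)).toFinset)).symm (avgRestrOfRecord F N p.K k (Set.toFinite (bondsIn k (s'.Ω (k + 1))ᶜ)).toFinset
              (Set.toFinite (bondsIn (k + 1) (s'.Ω (k + 1))ᶜ)).toFinset z.1, z.2))) k
          (Function.updateFinset ((baseCfg (V := V) (k + 1) ((MeasurableEquiv.piEquivPiSubtypeProd (fun _ : PBond (F.P p.K) (k + 1) => SU N)
            (· ∈ (Set.toFinite (bondsIn (k + 1) (s'.Ω (k + 1))ᶜ)).toFinset)).symm (avgRestrOfRecord F N p.K k (Set.toFinite (bondsIn k (s'.Ω (k + 1))ᶜ)).toFinset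
              (Set.toFinite (bondsIn (k + 1) (s'.Ω (k + 1))ᶜ)).toFinset z.1, z.2))) k).1 (Set.toFinite (bondsIn k (s'.Ω (k + 1))ᶜ)).toFinset z.1,
            ((baseCfg (V := V) (k + 1) ((MeasurableEquiv.piEquivPiSubtypeProd (fun _ : PBond (F.P p.K) (k + 1) => SU N)
            (· ∈ (Set.toFinite (bondsIn (k + 1) (s'.Ω (k + 1))ᶜ)).toFinset)).symm (avgRestrOfRecord F N p.K k (Set.toFinite (bondsIn k (s'.Ω (k + 1))ᶜ)).toFinset
              (Set.toFinite (bondsIn (k + 1) (s'.Ω (k + 1))ᶜ)).toFinset z.1, z.2))) k).2)) := by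
  -- the re-presentation `(y, v₂) ↦ ((avgRestrOfRecord y, v₂), y)` is measurable
  have hx : Measurable fun z : (↥(Set.toFinite (bondsIn k (s'.Ω (k + 1))ᶜ)).toFinset → SU N) ×
        ({c : PBond (F.P p.K) (k + 1) // c ∉ (Set.toFinite (bondsIn (k + 1) (s'.Ω (k + 1))ᶜ)).toFinset} → SU N) =>
      ((avgRestrOfRecord F N p.K k (Set.toFinite (bondsIn k (s'.Ω (k + 1))ᶜ)).toFinset (Set.toFinite (bondsIn (k + 1) (s'.Ω (k + 1))ᶜ)).toFinset z.1, z.2), z.1) :=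
    (((measurable_avgRestrOfRecord (F := F) (N := N) p.K k _ _).comp measurable_fst).prodMk measurable_snd).prodMk measurable_fst
  refine Finset.measurable_sum _ fun Y hY => ?_
  rw [Set.Finite.mem_toFinset] at hY
  -- the summand is the `hgm` integrand of the branch `S₀ ∪ {S_{k+1} = Y}`, whose old operator reads `init s′`
  have hmem : Function.update S₀ (k + 1) Y ∈ admSOfRecord F ν M g p.K (k + 1) s' := update_succ_mem_admSSeq_succ _ s' h₀ hY.1 hY.2
  have h := (hgm _ hmem).comp hx
  rw [tkBranchOfRecord_update_succ_eq_init] at h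
  exact h

/-- **THE INTRINSIC READING IDENTIFIES ITSELF ON THE AVERAGING FIBRES** (the shape of p619836's `hinner₀` ∕ p623644's per-old-branch identification, for `Fᵢ₀ S₀ := R̃_{S₀}`): on the
fibre `avgRestrOfRecord y = q.1` the glued coarse field `e′⁻¹(avgRestrOfRecord y, q.2)` IS `e′⁻¹ q`.  Pure logic (`subst`). [cite: Balaban1988Convergent, (2.21) p.258, (3.23) p.270 (bookkeeping)] -/
theorem intrinsicReading_identification (ν : Stage7Numerics) (M : ℕ) (g : ℕ → ℝ) (p : B12.RunParams) {k : ℕ}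
    {hdec : DecidableEq (PBond (F.P p.K) k)} {hdec' : DecidableEq (PBond (F.P p.K) (k + 1))}
    (s' : SeqOfRecord F ν M g p.K (k + 1)) (W : TkWeights F N V p.K) (Φ : SFluct (F.P p.K) V → B15DeterminingSets.MSField (F.P p.K) (SU N) → ℝ)
    (q : (↥(Set.toFinite (bondsIn (k + 1) (s'.Ω (k + 1))ᶜ)).toFinset → SU N) ×
      ({c : PBond (F.P p.K) (k + 1) // c ∉ (Set.toFinite (bondsIn (k + 1) (s'.Ω (k + 1))ᶜ)).toFinset} → SU N))
    (S₀ : ℕ → Set (Site (F.P p.K) 0)) (y : ↥(Set.toFinite (bondsIn k (s'.Ω (k + 1))ᶜ)).toFinset → SU N)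
    (hy : avgRestrOfRecord F N p.K k (Set.toFinite (bondsIn k (s'.Ω (k + 1))ᶜ)).toFinset (Set.toFinite (bondsIn (k + 1) (s'.Ω (k + 1))ᶜ)).toFinset y = q.1) :
    (∑ Y ∈ (Set.toFinite {Y : Set (Site (F.P p.K) 0) | Y ∈ SClassOfRecord F ν g p.K (k + 1) ∧ Y ⊆ s'.Ω (k + 1) ∩ (s'.Λ (k + 1))ᶜ}).toFinset,
        zetaOp (genDataOfRecord F N V ν M g p.K W s' (Function.update S₀ (k + 1) Y) k).ζ
          (aOp k (genDataOfRecord F N V ν M g p.K W s' (Function.update S₀ (k + 1) Y) k).sA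
            (genDataOfRecord F N V ν M g p.K W s' (Function.update S₀ (k + 1) Y) k).w
            (tkBranchOfRecord F N V ν M g p.K W s'.init S₀ k
              (fun ω => Φ (Function.update S₀ (k + 1) Y, fun j => (ω j).2) (fun j => (ω j).1))))
          (Function.update (baseCfg (k + 1) ((MeasurableEquiv.piEquivPiSubtypeProd (fun _ : PBond (F.P p.K) (k + 1) => SU N)
            (· ∈ (Set.toFinite (bondsIn (k + 1) (s'.Ω (k + 1))ᶜ)).toFinset)).symm (avgRestrOfRecord F N p.K k (Set.toFinite (bondsIn k (s'.Ω (k + 1))ᶜ)).toFinset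
              (Set.toFinite (bondsIn (k + 1) (s'.Ω (k + 1))ᶜ)).toFinset y, q.2))) k
          (Function.updateFinset ((baseCfg (V := V) (k + 1) ((MeasurableEquiv.piEquivPiSubtypeProd (fun _ : PBond (F.P p.K) (k + 1) => SU N)
            (· ∈ (Set.toFinite (bondsIn (k + 1) (s'.Ω (k + 1))ᶜ)).toFinset)).symm (avgRestrOfRecord F N p.K k (Set.toFinite (bondsIn k (s'.Ω (k + 1))ᶜ)).toFinset
              (Set.toFinite (bondsIn (k + 1) (s'.Ω (k + 1))ᶜ)).toFinset y, q.2))) k).1 (Set.toFinite (bondsIn k (s'.Ω (k + 1))ᶜ)).toFinset y,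
            ((baseCfg (V := V) (k + 1) ((MeasurableEquiv.piEquivPiSubtypeProd (fun _ : PBond (F.P p.K) (k + 1) => SU N)
            (· ∈ (Set.toFinite (bondsIn (k + 1) (s'.Ω (k + 1))ᶜ)).toFinset)).symm (avgRestrOfRecord F N p.K k (Set.toFinite (bondsIn k (s'.Ω (k + 1))ᶜ)).toFinset
              (Set.toFinite (bondsIn (k + 1) (s'.Ω (k + 1))ᶜ)).toFinset y, q.2))) k).2))) =
      ∑ Y ∈ (Set.toFinite {Y : Set (Site (F.P p.K) 0) | Y ∈ SClassOfRecord F ν g p.K (k + 1) ∧ Y ⊆ s'.Ω (k + 1) ∩ (s'.Λ (k + 1))ᶜ}).toFinset,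
        zetaOp (genDataOfRecord F N V ν M g p.K W s' (Function.update S₀ (k + 1) Y) k).ζ
          (aOp k (genDataOfRecord F N V ν M g p.K W s' (Function.update S₀ (k + 1) Y) k).sA
            (genDataOfRecord F N V ν M g p.K W s' (Function.update S₀ (k + 1) Y) k).w
            (tkBranchOfRecord F N V ν M g p.K W s'.init S₀ k
              (fun ω => Φ (Function.update S₀ (k + 1) Y, fun j => (ω j).2) (fun j => (ω j).1))))
          (Function.update (baseCfg (k + 1) ((MeasurableEquiv.piEquivPiSubtypeProd (fun _ : PBond (F.P p.K) (k + 1) => SU N)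
            (· ∈ (Set.toFinite (bondsIn (k + 1) (s'.Ω (k + 1))ᶜ)).toFinset)).symm q)) k
          (Function.updateFinset ((baseCfg (V := V) (k + 1) ((MeasurableEquiv.piEquivPiSubtypeProd (fun _ : PBond (F.P p.K) (k + 1) => SU N)
            (· ∈ (Set.toFinite (bondsIn (k + 1) (s'.Ω (k + 1))ᶜ)).toFinset)).symm q)) k).1 (Set.toFinite (bondsIn k (s'.Ω (k + 1))ᶜ)).toFinset y,
            ((baseCfg (V := V) (k + 1) ((MeasurableEquiv.piEquivPiSubtypeProd (fun _ : PBond (F.P p.K) (k + 1) => SU N)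
            (· ∈ (Set.toFinite (bondsIn (k + 1) (s'.Ω (k + 1))ᶜ)).toFinset)).symm q)) k).2)) := by
  obtain ⟨q₁, q₂⟩ := q
  subst hy
  rfl

/-- ★ **(O3′) ON THE NOSE FROM THE OLD-BRANCH CONDITIONAL-EXPECTATION IDENTITIES, `_of_laws`** (generic letters): dag-n11-w2's
`…OldBranchInnerSumOfProvisos.slotsTOfRecord_succ_ae_eq_TkOfRecord_succ_of_oldBranchInnerSum_of_laws` with the inner reading PINNED to the intrinsic one — inputs (form) the
`dU`-a.e. level-`k` identity on the `χ_k`-support, (hG₀) per-old-branch graph integrability, (hgm) joint measurability of the explicit new inside integrands, the new weights' laws,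
a nonnegative new operand, and (hce₀) ONE a.e. identity per old branch: def-T's skew conditional expectation of the old graph piece `=ᵐ[μ_out]` the intrinsic reading `R̃_{S₀}`.
Conclusion `slotsT_{k+1}(s′) =ᵐ[dV′] TkOfRecord … W (k+1) s′ Φ`. [cite: Balaban1988Convergent, (2.18) p.257, (2.20)–(2.21) p.258, (3.1) p.264, (3.23)–(3.25) p.270, §3 p.279, Thm 2 p.263] -/
theorem slotsTOfRecord_succ_ae_eq_TkOfRecord_succ_of_oldBranchCondExp_of_laws (ν : Stage7Numerics) (τ : TowerNumerics) (E : B12.RunParams → ℝ)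
    (w : StepWeightsOfRecord F N ν τ.M) (ppSel : PpSelOfRecord F ν τ.M) (p : B12.RunParams) (g : ℕ → ℝ) {k : ℕ} (hkK : k < p.K)
    {hdec : DecidableEq (PBond (F.P p.K) k)} {hdec' : DecidableEq (PBond (F.P p.K) (k + 1))} (hk : k + 1 ≤ (F.P p.K).m + (F.P p.K).K)
    (s' : SeqOfRecord F ν τ.M g p.K (k + 1)) (W₀ W : TkWeights F N V p.K)
    (Φ₀ Φ : SFluct (F.P p.K) V → B15DeterminingSets.MSField (F.P p.K) (SU N) → ℝ)
    (hform : ∀ᵐ U ∂fieldMeasure (F.P p.K) k (SU N), chiSeqOfRecord F N ν τ.M g p.K k s'.init U ≠ 0 →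
      slotsOfRecord F N ν τ E w ppSel p g k s'.init U = TkOfRecord F N V ν τ.M g p.K W₀ k s'.init Φ₀ U)
    (hG₀ : ∀ S₀ ∈ admSOfRecord F ν τ.M g p.K k s'.init, Integrable (fun U => w p g k s' U ((avOfRecord F N p.K k).avg U) *
      (chiSeqOfRecord F N ν τ.M g p.K k s'.init U *
        tkBranchOfRecord F N V ν τ.M g p.K W₀ s'.init S₀ k (fun ω => Φ₀ (S₀, fun j => (ω j).2) (fun j => (ω j).1)) (baseCfg k U)))
      (fieldMeasure (F.P p.K) k (SU N)))
    (hgm : ∀ S ∈ admSOfRecord F ν τ.M g p.K (k + 1) s', Measurable fun x :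
        ((↥(Set.toFinite (bondsIn (k + 1) (s'.Ω (k + 1))ᶜ)).toFinset → SU N) ×
            ({c : PBond (F.P p.K) (k + 1) // c ∉ (Set.toFinite (bondsIn (k + 1) (s'.Ω (k + 1))ᶜ)).toFinset} → SU N)) ×
          (↥(Set.toFinite (bondsIn k (s'.Ω (k + 1))ᶜ)).toFinset → SU N) =>
      zetaOp (genDataOfRecord F N V ν τ.M g p.K W s' S k).ζ
        (aOp k (genDataOfRecord F N V ν τ.M g p.K W s' S k).sA (genDataOfRecord F N V ν τ.M g p.K W s' S k).w
          (tkBranchOfRecord F N V ν τ.M g p.K W s' S k (fun ω => Φ (S, fun j => (ω j).2) (fun j => (ω j).1))))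
        (Function.update (baseCfg (k + 1) ((MeasurableEquiv.piEquivPiSubtypeProd (fun _ : PBond (F.P p.K) (k + 1) => SU N)
                (· ∈ (Set.toFinite (bondsIn (k + 1) (s'.Ω (k + 1))ᶜ)).toFinset)).symm x.1)) k
          (Function.updateFinset ((baseCfg (V := V) (k + 1) ((MeasurableEquiv.piEquivPiSubtypeProd (fun _ : PBond (F.P p.K) (k + 1) => SU N)
                (· ∈ (Set.toFinite (bondsIn (k + 1) (s'.Ω (k + 1))ᶜ)).toFinset)).symm x.1)) k).1 (Set.toFinite (bondsIn k (s'.Ω (k + 1))ᶜ)).toFinset x.2,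
            ((baseCfg (V := V) (k + 1) ((MeasurableEquiv.piEquivPiSubtypeProd (fun _ : PBond (F.P p.K) (k + 1) => SU N)
                (· ∈ (Set.toFinite (bondsIn (k + 1) (s'.Ω (k + 1))ᶜ)).toFinset)).symm x.1)) k).2)))
    (hW : W.Laws) (hΦ0 : ∀ S ∈ admSOfRecord F ν τ.M g p.K (k + 1) s', ∀ ω : MultiCfg (F.P p.K) (SU N) V, 0 ≤ Φ (S, fun j => (ω j).2) (fun j => (ω j).1))
    -- THE ONE IDENTITY PER OLD BRANCH: def-T's skew conditional expectation of the old graph piece = the intrinsic reading, `μ_out`-a.e.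
    (hce₀ : ∀ S₀ ∈ admSOfRecord F ν τ.M g p.K k s'.init, kernelTransport
        ((Measure.pi fun _ : ↥(Set.toFinite (bondsIn k (s'.Ω (k + 1))ᶜ)).toFinset => (HaarData.haar : Measure (SU N))).prod
          (Measure.pi fun _ : {b : PBond (F.P p.K) k // b ∉ (Set.toFinite (bondsIn k (s'.Ω (k + 1))ᶜ)).toFinset} => (HaarData.haar : Measure (SU N))))
        ((Measure.pi fun _ : ↥(Set.toFinite (bondsIn k (s'.Ω (k + 1))ᶜ)).toFinset => (HaarData.haar : Measure (SU N))).prod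
          (Measure.pi fun _ : {c : PBond (F.P p.K) (k + 1) // c ∉ (Set.toFinite (bondsIn (k + 1) (s'.Ω (k + 1))ᶜ)).toFinset} =>
            (HaarData.haar : Measure (SU N))))
        (fun q => (q.1, fun c : {c : PBond (F.P p.K) (k + 1) // c ∉ (Set.toFinite (bondsIn (k + 1) (s'.Ω (k + 1))ᶜ)).toFinset} =>
          (avOfRecord F N p.K k).avg
            ((MeasurableEquiv.piEquivPiSubtypeProd (fun _ : PBond (F.P p.K) k => SU N)
              (· ∈ (Set.toFinite (bondsIn k (s'.Ω (k + 1))ᶜ)).toFinset)).symm q) c))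
        ((fun U => w p g k s' U ((avOfRecord F N p.K k).avg U) *
            (chiSeqOfRecord F N ν τ.M g p.K k s'.init U *
              tkBranchOfRecord F N V ν τ.M g p.K W₀ s'.init S₀ k (fun ω => Φ₀ (S₀, fun j => (ω j).2) (fun j => (ω j).1)) (baseCfg k U))) ∘
          ⇑(MeasurableEquiv.piEquivPiSubtypeProd (fun _ : PBond (F.P p.K) k => SU N)
            (· ∈ (Set.toFinite (bondsIn k (s'.Ω (k + 1))ᶜ)).toFinset)).symm)
      =ᵐ[((Measure.pi fun _ : ↥(Set.toFinite (bondsIn k (s'.Ω (k + 1))ᶜ)).toFinset => (HaarData.haar : Measure (SU N))).prod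
          (Measure.pi fun _ : {c : PBond (F.P p.K) (k + 1) // c ∉ (Set.toFinite (bondsIn (k + 1) (s'.Ω (k + 1))ᶜ)).toFinset} =>
            (HaarData.haar : Measure (SU N))))]
        fun z => ∑ Y ∈ (Set.toFinite {Y : Set (Site (F.P p.K) 0) | Y ∈ SClassOfRecord F ν g p.K (k + 1) ∧ Y ⊆ s'.Ω (k + 1) ∩ (s'.Λ (k + 1))ᶜ}).toFinset,
          zetaOp (genDataOfRecord F N V ν τ.M g p.K W s' (Function.update S₀ (k + 1) Y) k).ζ
            (aOp k (genDataOfRecord F N V ν τ.M g p.K W s' (Function.update S₀ (k + 1) Y) k).sA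
              (genDataOfRecord F N V ν τ.M g p.K W s' (Function.update S₀ (k + 1) Y) k).w
              (tkBranchOfRecord F N V ν τ.M g p.K W s'.init S₀ k
                (fun ω => Φ (Function.update S₀ (k + 1) Y, fun j => (ω j).2) (fun j => (ω j).1))))
            (Function.update (baseCfg (k + 1) ((MeasurableEquiv.piEquivPiSubtypeProd (fun _ : PBond (F.P p.K) (k + 1) => SU N)
              (· ∈ (Set.toFinite (bondsIn (k + 1) (s'.Ω (k + 1))ᶜ)).toFinset)).symm (avgRestrOfRecord F N p.K k (Set.toFinite (bondsIn k (s'.Ω (k + 1))ᶜ)).toFinset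
                (Set.toFinite (bondsIn (k + 1) (s'.Ω (k + 1))ᶜ)).toFinset z.1, z.2))) k
            (Function.updateFinset ((baseCfg (V := V) (k + 1) ((MeasurableEquiv.piEquivPiSubtypeProd (fun _ : PBond (F.P p.K) (k + 1) => SU N)
              (· ∈ (Set.toFinite (bondsIn (k + 1) (s'.Ω (k + 1))ᶜ)).toFinset)).symm (avgRestrOfRecord F N p.K k (Set.toFinite (bondsIn k (s'.Ω (k + 1))ᶜ)).toFinset
                (Set.toFinite (bondsIn (k + 1) (s'.Ω (k + 1))ᶜ)).toFinset z.1, z.2))) k).1 (Set.toFinite (bondsIn k (s'.Ω (k + 1))ᶜ)).toFinset z.1,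
              ((baseCfg (V := V) (k + 1) ((MeasurableEquiv.piEquivPiSubtypeProd (fun _ : PBond (F.P p.K) (k + 1) => SU N)
              (· ∈ (Set.toFinite (bondsIn (k + 1) (s'.Ω (k + 1))ᶜ)).toFinset)).symm (avgRestrOfRecord F N p.K k (Set.toFinite (bondsIn k (s'.Ω (k + 1))ᶜ)).toFinset
                (Set.toFinite (bondsIn (k + 1) (s'.Ω (k + 1))ᶜ)).toFinset z.1, z.2))) k).2))) :
    slotsTOfRecord F N ν τ E w ppSel p g (k + 1) s' =ᵐ[fieldMeasure (F.P p.K) (k + 1) (SU N)] TkOfRecord F N V ν τ.M g p.K W (k + 1) s' Φ :=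
  slotsTOfRecord_succ_ae_eq_TkOfRecord_succ_of_oldBranchInnerSum_of_laws ν τ E w ppSel p g hkK (hdec := hdec) (hdec' := hdec') hk s' W₀ W Φ₀ Φ hform hG₀ _
    (fun S₀ h₀ => measurable_intrinsicReading_of_hgm ν τ.M g p (hdec := hdec) (hdec' := hdec') s' W Φ hgm S₀ h₀) hce₀ hgm hW hΦ0
    (Filter.Eventually.of_forall fun q S₀ _ y hy => intrinsicReading_identification ν τ.M g p (hdec := hdec) (hdec' := hdec') s' W Φ q S₀ y hy)

end Generic

end Summit.QuantumFields.YangMills.Theorems.BalabanUVNodesN11O3OfIntrinsicReading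

end
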